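/-
Origin: expansion seat `planner-pub-hodgecm-pv10-0`, handover #3 2026-08-18T04:00:05Z (`HOME/pub-hodgecm-pv10/lean/Pv10/HeckeCharUnramified.lean`, md5 cc0ec03f, 114 lines);
landed by the gen-5 packager in gate run 21 as `HodgeCM/PerL34/HeckeCharUnramified.lean` (import ^import Pv[0-9]+\.→import HodgeCM.PerL34. ×1).
-/
/-
Origin: planner-pub-hodgecm-pv10-0 (unit pub-hodgecm-pv10), HodgeCM publication cell, 2026-08-18.
Node N31g (PerL v5 Lemma 4.2(b) pf, tex ll. 623–625: "a continuous character is unramified at almost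
all places") over Mathlib's REAL ideles.  At landing `Pv10.IdeleClassGroup` → `HodgeCM.PerL34.IdeleClassGroup`.
-/
import Summits.HodgeConjecture.HodgeCM.PerL34.IdeleClassGroup
import Summits.HodgeConjecture.HodgeCM.PerL34.NoSmallSubgroups
import Mathlib.Topology.Algebra.Group.Units

/-!
# N31g over Mathlib's ideles: continuous characters are unramified at almost all places

For a product `Π i, G i` of topological groups and a continuous unitary character `φ`, `φ` is trivial
on the `i`-th factor for all but finitely many `i` (`Pi.continuousChar_trivial_on_almost_all`; the
abstract restricted-product version is `NoSmallSubgroups.RestrictedProduct.continuousChar_trivial_on_almost_all`).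
Applied to `(Π v, 𝒪_v)^× ≅ Π v, 𝒪_v^×` and the maps of `IdeleClassGroup.lean`:

* `NumberField.continuousChar_intUnits_unramified` — a continuous `χ : (∏_v 𝒪_v)^× → S¹` kills
  `𝒪_v^×` for almost all `v`;
* `NumberField.UnitaryHeckeCharacter.unramified` — every unitary Hecke character `ψ : C_K → S¹` is
  UNRAMIFIED at all but finitely many finite places: `ψ [ι_v u] = 1` for all `u ∈ 𝒪_v^×`, where
  `ι_v u ∈ (∏_w 𝒪_w)^×` is `u` at `v` and `1` elsewhere.
-/

set_option autoImplicit false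

noncomputable section

open Topology Filter Set

/-! ## Products: a continuous unitary character is trivial on almost all factors -/

namespace Pi

open HodgeCM.PerL34.NoSmallSubgroups

/-- A continuous unitary character of a product of topological groups is trivial on the `i`-th factor
(embedded by `MonoidHom.mulSingle`) for all but finitely many `i`. -/
theorem continuousChar_trivial_on_almost_all {ι : Type*} [DecidableEq ι] {G : ι → Type*}
    [∀ i, Group (G i)] [∀ i, TopologicalSpace (G i)] (φ : (∀ i, G i) →* Circle) (hφ : Continuous φ) :
    ∀ᶠ i in Filter.cofinite, ∀ x : G i, φ (Pi.mulSingle i x) = 1 := by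
  obtain ⟨U, hU, hker⟩ := exists_nhds_one_forall_subgroup_le_ker φ hφ
  rw [nhds_pi, Filter.mem_pi] at hU
  obtain ⟨I, hI, t, ht, hts⟩ := hU
  refine Filter.mem_of_superset (hI.compl_mem_cofinite) ?_
  intro i hi x
  have hle : (MonoidHom.mulSingle G i).range ≤ φ.ker := by
    apply hker
    rintro _ ⟨y, rfl⟩
    apply hts
    intro j hj
    have hji : j ≠ i := fun h => hi (h ▸ hj)
    show Pi.mulSingle i y j ∈ t j
    rw [Pi.mulSingle_eq_of_ne hji]
    exact mem_of_mem_nhds (ht j)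
  exact (MonoidHom.mem_ker).mp (hle ⟨x, rfl⟩)

end Pi

/-! ## Real ideles -/

namespace NumberField

open IsDedekindDomain IsDedekindDomain.HeightOneSpectrum

variable (K : Type*) [Field K] [NumberField K]

open scoped Classical in
/-- `ι_v : 𝒪_v^× → (∏_w 𝒪_w)^×`, `u ↦ (u at v, 1 elsewhere)`. -/
def localUnitsToIntUnits (v : HeightOneSpectrum (𝓞 K)) :
    (v.adicCompletionIntegers K)ˣ →* (integralAdeles K)ˣ :=
  (ContinuousMulEquiv.piUnits (M := fun w : HeightOneSpectrum (𝓞 K) => w.adicCompletionIntegers K)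
      ).symm.toMonoidHom.comp
    (MonoidHom.mulSingle (fun w : HeightOneSpectrum (𝓞 K) => (w.adicCompletionIntegers K)ˣ) v)

open scoped Classical in
/-- (Ported verbatim from the HodgeCMPerL package; no docstring in the source.) -/
theorem continuous_localUnitsToIntUnits (v : HeightOneSpectrum (𝓞 K)) :
    Continuous (localUnitsToIntUnits K v) :=
  (ContinuousMulEquiv.piUnits
      (M := fun w : HeightOneSpectrum (𝓞 K) => w.adicCompletionIntegers K)).symm.continuous.comp
    (continuous_mulSingle (A := fun w : HeightOneSpectrum (𝓞 K) => (w.adicCompletionIntegers K)ˣ) v)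

/-- **N31g for `(∏_v 𝒪_v)^×`.**  A continuous unitary character of `(∏_v 𝒪_v)^×` is trivial on `𝒪_v^×`
for all but finitely many `v`. -/
theorem continuousChar_intUnits_unramified (χ : (integralAdeles K)ˣ →* Circle) (hχ : Continuous χ) :
    ∀ᶠ v in Filter.cofinite, ∀ u : (v.adicCompletionIntegers K)ˣ, χ (localUnitsToIntUnits K v u) = 1 := by
  classical
  let e := (ContinuousMulEquiv.piUnits
    (M := fun w : HeightOneSpectrum (𝓞 K) => w.adicCompletionIntegers K)).symm
  have h := Pi.continuousChar_trivial_on_almost_all (χ.comp e.toMonoidHom) (hχ.comp e.continuous)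
  refine h.mono fun v hv u => ?_
  have := hv u
  simpa [localUnitsToIntUnits] using this

/-- **N31g for unitary Hecke characters.**  A unitary Hecke character of `K` is unramified at all but
finitely many finite places. -/
theorem UnitaryHeckeCharacter.unramified (ψ : UnitaryHeckeCharacter K) :
    ∀ᶠ v in Filter.cofinite, ∀ u : (v.adicCompletionIntegers K)ˣ,
      ψ (intUnitsToClass K (localUnitsToIntUnits K v u)) = 1 := by
  have h := continuousChar_intUnits_unramified K (ψ.toMonoidHom.comp (intUnitsToClass K))
    (ψ.continuous.comp (continuous_intUnitsToClass K))
  exact h.mono fun v hv u => hv u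

/-- The same for any continuous unitary character of the idele group `𝔸_K^×`. -/
theorem continuousChar_idele_unramified (χ : ideleGroup K →* Circle) (hχ : Continuous χ) :
    ∀ᶠ v in Filter.cofinite, ∀ u : (v.adicCompletionIntegers K)ˣ,
      χ (intUnitsToIdele K (localUnitsToIntUnits K v u)) = 1 := by
  have h := continuousChar_intUnits_unramified K (χ.comp (intUnitsToIdele K))
    (hχ.comp (continuous_intUnitsToIdele K))
  exact h.mono fun v hv u => hv u

end NumberField

end
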